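import Mathlib
import HarnessLib
import Summits.HubbardSuperconductivity.HubbardSuperconductivity.Theorems.WeakCouplingBCSKlCertKlPtE1ChunksA
import Summits.HubbardSuperconductivity.HubbardSuperconductivity.Theorems.WeakCouplingBCSKlCertKlPtE1ChunksB
import Summits.HubbardSuperconductivity.HubbardSuperconductivity.Theorems.WeakCouplingBCSKlCertKlPtE1ChunksC

/-!
# Route `WeakCouplingBCS` — crux `WcbcsBcsConstruction` (stmt-HubbardSuperconductivity-2010), stub `stub_klPointEnclosure` (Penc):
# ROWS E1 OF THE ONE-POINT RECORD — `0.999 ≤ ∫ Φ² dσ_{-21/25} ≤ 1.001` for the `B1g` trial of `klPt`, kernel-checked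

The registered stub (Penc) `stub_klPointEnclosure : ∀ χ, (klPtBox.blk χ).EnclosureR klPtTab (-(21:ℝ)/25) χ`
(`Cruxes/WcbcsBcsConstruction/Lines/ladder_scale_certified_chain.lean`, shared VERBATIM with stmt-1740's `ladder_scale_transfer.lean`) is ten
certified integral inequalities (`Cruxes/CwChiralConstruction/PointCertTarget.md` §2).  This file PROVES the two kernel-free ones — rows 1–2, the
`E1` conjuncts `Nlo ≤ ∫ Φ² dσ_μ ≤ Nhi` of the `B1g` trial block (`Nlo = 999/1000`, `Nhi = 1001/1000`; float `N = 0.9999916`) — for the trial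
`klPtB1g` (`WeakCouplingBCSKlCertKlPtE1Prelude.lean`; byte-identical to `klTab klPtTab klPtBox.bB1g.trial = klPt_t1`, whose home module has no olean
on the farm today, so the record-field form `klPtBox.bB1g.Nlo ≤ ∫ (klPtBox.bB1g.trialFun klPtTab k)² ∂σ ≤ klPtBox.bB1g.Nhi` is the `rfl`-transport
of `klPtB1g_normSq_mem` below, to be stated in a 5-line file once `ChiralWindowDefsPointRecord` builds again):

* the tangent-model quadrature of `WeakCouplingBCSKlCertQuadOrder1(Chain).lean` (reduced-argument evaluator of `…TrigReduced.lean`) on the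
  1147-cell certified chain of `WeakCouplingBCSKlCertKlPtE1Chunks{A,B,C}.lean` — certified brackets `0.999205 ≤ N ≤ 1.000779`;
* the polar transport `klpt_integral_comp_toFun` (R1) and the `D₄` reduction `integral_klPtB1g_sq_eq_eight_mul`.

What remains of (Penc): rows 3–10 (E2, E3R for the trial — `∫ Φ F dσ`, `∫ (F - sΦ)² dσ` with `F = ∫ χ₀(k+k') Φ(k') dσ(k')` — and E4 for the
five sector kernels): all involve the Lindhard kernel and need a certified RANGE engine for `√w χ₀ √w'` at width `≈ 10⁻³` (the tree's sound point
engine `WeakCouplingBCSKlLindhardEnclosureSound.lean` certifies single values).  Honest framing: two of ten inequalities of ONE registered stub; no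
channel order, no `U₀`, nothing about superconductivity in the Hubbard model is proved here. [folklore]
-/

noncomputable section

-- the tree's namespace `Summit.<Summit>.<Problem>.Theorems` repeats the summit name by design (D-0017)
set_option linter.dupNamespace false

namespace Summit.HubbardSuperconductivity.HubbardSuperconductivity.Theorems.KlCertQuad

open Real Set MeasureTheory CwKLChiralWindow Literature.MathematicalPhysics.QuantumLattice

/-- The long chain (1147 cells; ends at `115847/147456 ≥ π/4`). [folklore] -/
def e1Long : List DOSCell := e1PartA ++ e1PartB ++ e1PartC

/-- The short chain (1146 cells; ends below `π/4`). [folklore] -/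
def e1Short : List DOSCell := e1PartA ++ e1PartB ++ e1PartCshort

/-- The long chain is certified, reaches `π/4`, and `8 ×` its upper bracket is at most `1001/1000` (`8 × ((537289229 : ℚ) / 4294967296) = 1.0007792`). [folklore] -/
theorem e1Long_ok : chainOK ((-21 : ℚ) / 25) 0 e1Long = true ∧ pi4Hi ≤ endOf 0 e1Long ∧ 8 * t1UpperSum klPtB1g e1Long ≤ (1001 : ℚ) / 1000 := by
  have gAB := chainOK_glue e1PartA_ok.1 e1PartA_ok.2.1 e1PartB_ok.1
  have gABC := chainOK_glue gAB.1 (gAB.2.trans e1PartB_ok.2.1) e1PartC_ok.1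
  refine ⟨gABC.1, ?_, ?_⟩
  · rw [show endOf 0 e1Long = ((115847 : ℚ) / 147456) from gABC.2.trans e1PartC_ok.2.1, pi4Hi]
    norm_num
  · simp only [e1Long, t1UpperSum_append]
    linarith [e1PartA_ok.2.2.2, e1PartB_ok.2.2.2, e1PartC_ok.2.2.2]

/-- The short chain is certified, stays below `π/4`, and `8 ×` its lower bracket is at least `999/1000` (`8 × ((536444263 : ℚ) / 4294967296) = 0.9992053`). [folklore] -/
theorem e1Short_ok : chainOK ((-21 : ℚ) / 25) 0 e1Short = true ∧ endOf 0 e1Short ≤ pi4Lo ∧ (999 : ℚ) / 1000 ≤ 8 * t1LowerSum klPtB1g e1Short := by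
  have gAB := chainOK_glue e1PartA_ok.1 e1PartA_ok.2.1 e1PartB_ok.1
  have gABC := chainOK_glue gAB.1 (gAB.2.trans e1PartB_ok.2.1) e1PartCshort_ok.1
  refine ⟨gABC.1, gABC.2.trans_le e1PartCshort_ok.2.1, ?_⟩
  simp only [e1Short, t1LowerSum_append]
  linarith [e1PartA_ok.2.2.1, e1PartB_ok.2.2.1, e1PartCshort_ok.2.2]

/-- **Rows E1 of the one-point record**: `999/1000 ≤ ∫ Φ² dσ_{-21/25} ≤ 1001/1000` for the `B1g` trial `Φ = klPtB1g.toFun`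
(`= klPtBox.bB1g.trialFun klPtTab` by `rfl`) against the Fermi-curve measure at `μ = -21/25` — certified chain brackets
`[0.999205, 1.000779]`, float `0.9999916`. [folklore] -/
theorem klPtB1g_normSq_mem :
    (999 / 1000 : ℝ) ≤ ∫ k, klPtB1g.toFun k ^ 2 ∂fermiCurveMeasure (squareDispersion 1 0) (-(21:ℝ) / 25) ∧
      ∫ k, klPtB1g.toFun k ^ 2 ∂fermiCurveMeasure (squareDispersion 1 0) (-(21:ℝ) / 25) ≤ (1001 / 1000 : ℝ) := by
  have hμ := klPtMu_mem
  have hμeq : (-(21:ℝ) / 25) = ((((-21 : ℚ) / 25) : ℚ) : ℝ) := by push_cast; ring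
  have hR1 : ∫ k, klPtB1g.toFun k ^ 2 ∂fermiCurveMeasure (squareDispersion 1 0) ((((-21 : ℚ) / 25) : ℚ) : ℝ) =
      ∫ θ in Ioc (-π) π, fermiPolarDOS ((((-21 : ℚ) / 25) : ℚ) : ℝ) θ * klPtB1g.eval θ ^ 2 :=
    klpt_integral_comp_toFun hμ.1 hμ.2 klPtB1g (continuous_pow 2)
  rw [hμeq, hR1, ← intervalIntegral.integral_of_le (by linarith [Real.pi_pos]), integral_klPtB1g_sq_eq_eight_mul hμ.1 hμ.2]
  have hq := quarter_t1integral_mem hμ.1 hμ.2 klPtB1g klPtB1g_sinC e1Short_ok.1 e1Long_ok.1 e1Short_ok.2.1 e1Long_ok.2.1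
  have hlo' : (999 / 1000 : ℝ) ≤ 8 * ((t1LowerSum klPtB1g e1Short : ℚ) : ℝ) := by
    have := (Rat.cast_le (K := ℝ)).mpr e1Short_ok.2.2; push_cast at this; linarith
  have hhi' : 8 * ((t1UpperSum klPtB1g e1Long : ℚ) : ℝ) ≤ 1001 / 1000 := by
    have := (Rat.cast_le (K := ℝ)).mpr e1Long_ok.2.2; push_cast at this; linarith
  constructor <;> linarith [hq.1, hq.2]

end Summit.HubbardSuperconductivity.HubbardSuperconductivity.Theorems.KlCertQuad

end
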